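import Summits.Ventures.CertifiedQuantumChemistry.Rows.CARNormalOrderSound
import Literature.MathematicalPhysics.QuantumLattice.HubbardWindowCertificate
import HarnessLib

/-!
# Syntactic term lists for lattice-window certificates on top of the quantum-chemistry cell's CAR normal-ordering
# engine (`CertifiedQuantumChemistry/Rows/CARNormalOrder{,Sound}.lean`): products, adjoints, letter maps, charges,
# SOS-factor Gram lists, commutator (eom) lists, and the RESIDUAL SPLIT of a collected polynomial

HONEST FRAMING: kernel-evaluable SYNTAX + its semantics in the tree's Jordan–Wigner matrices (Lean plumbing towards «tier P» =
replacing a claim node's certificate IDENTITY hypothesis by a kernel computation); no number, no claim node, nothing is discharged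
here; the rows this serves are CONTROL/CALIBRATION stiffness-scale CEILINGS (wording (xx1)), silent on the presence of
superconductivity; not a `T_c` or phase sentence; no summit statement is proved by this file. Seat hubbard-obs-p2 (STIFFNESS),
`prover-hubbard-obs-p2-g22-0`, zero compute. Companion memo: HOME/hubbard-obs-p2/TIER-P-SIZING-g22-ADDENDUM.md.

WHAT THIS IS. The window-certificate soundness theorems of the tree
(`Literature/…/HubbardNNNHoppingCorrelatorWindowCertificate.re_orbitState_ge_of_window_certificate_d4_TT'_ineq`, its
thermodynamic-limit readers `…TorusLimitCorrelator{,Affine}`) take ONE hypothesis `hcert` — an identity in the window algebra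
`𝔄_{Λ'} = FermionOp Λ'` between the objective side and Han's families (Gram part, `[H_{Λ'}, Bₖ]`, licensed affine-`D₄` moves,
charged words, anti-Hermitian parts, residual words `Σ aₖ wₖ` priced `−Σ‖aₖ‖`). The quantum-chemistry cell's engine decides such
identities symbolically: `CARPoly.normalize` normal-orders and collects a term list, `evalPoly d` is its meaning through an
injective letter map `d : α → ι` into the tree's `ladderWord`s, `evalPoly_normalize` says normalisation does not change the
operator, and `lowerConst = constCoeff − ℓ¹(non-unit coefficients)`. This file adds the term-list ALGEBRA a lattice window
certificate needs, generic in the letter type `α` and the target orbital type `ι` (for us `ι = Orb (PolySite Λ')`):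

* §1 syntax (computable, structural): `Terms α = List (word × ℚ)`, `negT`, `scaleT`, `unitT`, `mulT` (concatenation),
  `daggerW`/`daggerT` (reversed, flipped), `commT H B = H·B − B·H`, `wmapT f` (letter map), `finL n`, `chargeW`, `spinChargeW`,
  `gramT K Q = Σ_q (2^{−K} q)† (2^{−K} q)` (SOS-FACTOR form: `Q` = the factor polynomials, PSD by construction),
  `eomT H Bs = Σ_k [H, B_k]`;
* §2 semantics `termOp d T = Σ_t c_t • ladderWord (wmap d w_t)` and its algebra (`termOp_append/_negT/_scaleT/_mulT/_daggerT/
  _commT/_wmapT/_unitT/_flatMap_finL`), `evalPoly_termsToPoly'`/`evalPoly_normalize'` (the engine's soundness in `termOp` form),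
  `fermionEmbed_termOp` (`Γ(φ)` acts letterwise: `Γ(φ)(termOp d T) = termOp (embMap φ ∘ d) T`), `ladderCharge_wmap` /
  `ladderSpinCharge_wmap` (charges are computable on the syntax), `termOp_gramT_eq_gramForm` (the Gram list IS
  `gramForm 1 O` with `Oᵢ = 2^{−K} • termOp d qᵢ`, and `1 ⪰ 0`), `termOp_eomT`;
* the RESIDUAL SPLIT (`evalPoly d P = (constCoeff P)·1 + Σ_k resCoeff P k • ladderWord (resWord d P k)`,
  `Σ_k ‖resCoeff P k‖ = l1Nonconst P`) is in the companion `Rows/CARPolyWindowResidual.lean`.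

Everything is PROVED (0 sorry); the `def`s are list programs and two index readers. References: O. Bratteli, D. W. Robinson,
*Operator Algebras and Quantum Statistical Mechanics 2*, §5.2.2 (CAR) [BratteliRobinsonII1997]; X. Han, arXiv:2006.06002 §3
(the square-lattice constraint families) [Han2020Bootstrap]; C. Jansson, D. Chaykin, C. Keil, SIAM J. Numer. Anal. 46 (2008) 180
(rigorous bounds from inexact certificates: residual absorbed by a norm bound) [JanssonChaykinKeil2008].
-/

namespace Summit.Ventures.CertifiedManyBodySolver

namespace CARPolyWindow

open Summit.Ventures.CertifiedQuantumChemistry Summit.Ventures.CertifiedQuantumChemistry.CARPoly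
open Literature.MathematicalPhysics.QuantumLattice Literature.MathematicalPhysics.QuantumLattice.HubbardWave0
open Literature.MathematicalPhysics.QuantumManyBody.StateRelaxation
open Matrix
open scoped ComplexOrder BigOperators

/-! ## §1 Syntax (computable) -/

section Syntax

variable {α β : Type*}

/-- Term lists `Σ_t c_t · word_t` over letters `α × Bool` (`true` = creation). [folklore] -/
abbrev Terms (α : Type*) := List (List (α × Bool) × ℚ)

/-- Negate all coefficients. [folklore] -/
def negT (T : Terms α) : Terms α := T.map fun wc => (wc.1, -wc.2)

/-- Scale all coefficients by `q`. [folklore] -/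
def scaleT (q : ℚ) (T : Terms α) : Terms α := T.map fun wc => (wc.1, q * wc.2)

/-- The scalar `q · 1` (empty word). [folklore] -/
def unitT (q : ℚ) : Terms α := [([], q)]

/-- Product of term lists (words concatenated, coefficients multiplied). [folklore] -/
def mulT (A B : Terms α) : Terms α := A.flatMap fun a => B.map fun b => (a.1 ++ b.1, a.2 * b.2)

/-- The adjoint word: reversed, daggers flipped. [folklore] -/
def daggerW (w : List (α × Bool)) : List (α × Bool) := w.reverse.map fun l => (l.1, !l.2)

/-- The adjoint of a term list (real coefficients). [folklore] -/
def daggerT (T : Terms α) : Terms α := T.map fun wc => (daggerW wc.1, wc.2)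

/-- The commutator list `H·B − B·H`. [folklore] -/
def commT (H B : Terms α) : Terms α := mulT H B ++ negT (mulT B H)

/-- Push a term list along a letter map `f : β → α`. [folklore] -/
def wmapT (f : β → α) (T : Terms β) : Terms α := T.map fun wc => (wc.1.map fun l => (f l.1, l.2), wc.2)

/-- The list `[0, …, n−1]` of `Fin n` (structural). [folklore] -/
def finL : (n : ℕ) → List (Fin n)
  | 0 => []
  | n + 1 => (0 : Fin (n + 1)) :: (finL n).map Fin.succ

/-- Charge `#creators − #annihilators` of a syntactic word. [folklore] -/
def chargeW (w : List (α × Bool)) : ℤ := (w.map fun p => if p.2 then (1 : ℤ) else -1).sum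

/-- `2S^z`-charge of a syntactic word, given the spin `sp a ∈ {0 = ↑, 1 = ↓}` of each letter. [folklore] -/
def spinChargeW (sp : α → Fin 2) (w : List (α × Bool)) : ℤ :=
  (w.map fun p => (if p.2 then (1 : ℤ) else -1) * (if sp p.1 = 0 then (1 : ℤ) else -1)).sum

/-- SOS-FACTOR Gram list: `Σ_{q ∈ Q} (2^{−K} q)† (2^{−K} q)` (coefficients `4^{−K}`; the factors `q` are the columns of an
integer `LDLᵀ`/Cholesky factor of a PSD block, so positivity holds BY CONSTRUCTION). [folklore] -/
def gramT (K : ℕ) (Q : List (Terms α)) : Terms α := Q.flatMap fun q => scaleT (1 / 4 ^ K) (mulT (daggerT q) q)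

/-- Equation-of-motion list: `Σ_k (H·B_k − B_k·H)` (multipliers already inside the `B_k`). [folklore] -/
def eomT (H : Terms α) (Bs : List (Terms α)) : Terms α := Bs.flatMap fun B => commT H B

end Syntax

/-! ## §2 Semantics -/

section Semantics

variable {α β : Type*} {ι : Type*} [LinearOrder ι] [Fintype ι]

/-- The operator a term list denotes through the letter map `d`: `Σ_t c_t • ladderWord (wmap d w_t)`. [folklore] -/
noncomputable def termOp (d : α → ι) (T : Terms α) : Matrix (Finset ι) (Finset ι) ℂ :=
  (T.map fun wc => ((wc.2 : ℚ) : ℂ) • ladderWord (wmap d wc.1)).sum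

/-- `termOp` of the empty list. [folklore] -/
@[simp] theorem termOp_nil (d : α → ι) : termOp d ([] : Terms α) = 0 := rfl

/-- `termOp` of a cons. [folklore] -/
theorem termOp_cons (d : α → ι) (wc : List (α × Bool) × ℚ) (T : Terms α) :
    termOp d (wc :: T) = ((wc.2 : ℚ) : ℂ) • ladderWord (wmap d wc.1) + termOp d T := rfl

/-- `termOp` is additive under concatenation. [folklore] -/
theorem termOp_append (d : α → ι) (A B : Terms α) : termOp d (A ++ B) = termOp d A + termOp d B := by
  simp [termOp, List.map_append, List.sum_append]

/-- `termOp (negT T) = −termOp T`. [folklore] -/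
theorem termOp_negT (d : α → ι) (T : Terms α) : termOp d (negT T) = -termOp d T := by
  induction T with
  | nil => simp [negT]
  | cons wc T ih =>
    have h : negT (wc :: T) = (wc.1, -wc.2) :: negT T := rfl
    rw [h, termOp_cons, termOp_cons, ih, Rat.cast_neg, neg_smul, neg_add]

/-- `termOp (scaleT q T) = q • termOp T`. [folklore] -/
theorem termOp_scaleT (d : α → ι) (q : ℚ) (T : Terms α) : termOp d (scaleT q T) = ((q : ℚ) : ℂ) • termOp d T := by
  induction T with
  | nil => simp [scaleT]
  | cons wc T ih =>
    have h : scaleT q (wc :: T) = (wc.1, q * wc.2) :: scaleT q T := rfl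
    rw [h, termOp_cons, termOp_cons, ih, Rat.cast_mul, smul_add, mul_smul]

/-- `termOp (unitT q) = q • 1`. [folklore] -/
theorem termOp_unitT (d : α → ι) (q : ℚ) : termOp d (unitT q : Terms α) = ((q : ℚ) : ℂ) • 1 := by
  simp [unitT, termOp, wmap]

omit [LinearOrder ι] [Fintype ι] in
/-- `wmap` of a concatenation. [folklore] -/
theorem wmap_append' (d : α → ι) (w w' : List (α × Bool)) : wmap d (w ++ w') = wmap d w ++ wmap d w' := by
  simp [wmap]

/-- A concatenated word denotes the product. [folklore] -/
theorem ladderWord_append'' (w w' : List (ι × Bool)) : ladderWord (w ++ w') = ladderWord w * ladderWord w' := by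
  induction w with
  | nil => simp
  | cons p w ih => rw [List.cons_append, ladderWord_cons, ladderWord_cons, ih, mul_assoc]

/-- One term times a list. [folklore] -/
theorem termOp_map_mulWord (d : α → ι) (a : List (α × Bool) × ℚ) (B : Terms α) :
    termOp d (B.map fun b => (a.1 ++ b.1, a.2 * b.2)) = (((a.2 : ℚ) : ℂ) • ladderWord (wmap d a.1)) * termOp d B := by
  induction B with
  | nil => simp
  | cons b B ih =>
    rw [List.map_cons, termOp_cons, termOp_cons, ih, mul_add, wmap_append', ladderWord_append'', Rat.cast_mul,
      smul_mul_smul_comm, mul_smul, smul_smul]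

/-- **`termOp (mulT A B) = termOp A * termOp B`.** [folklore] -/
theorem termOp_mulT (d : α → ι) (A B : Terms α) : termOp d (mulT A B) = termOp d A * termOp d B := by
  induction A with
  | nil => simp [mulT]
  | cons a A ih =>
    have h : mulT (a :: A) B = (B.map fun b => (a.1 ++ b.1, a.2 * b.2)) ++ mulT A B := rfl
    rw [h, termOp_append, ih, termOp_map_mulWord, termOp_cons, add_mul]

omit [Fintype ι] in
/-- The adjoint of a ladder letter is the flipped letter. [folklore] -/
theorem conjTranspose_ladderLetter' (l : ι × Bool) : (ladderLetter l)ᴴ = ladderLetter (l.1, !l.2) := by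
  obtain ⟨i, b⟩ := l
  cases b
  · simp [ladderLetter, annihilation_conjTranspose]
  · simp [ladderLetter, creation_conjTranspose]

omit [LinearOrder ι] [Fintype ι] in
/-- `wmap` commutes with `daggerW`. [folklore] -/
theorem wmap_daggerW (d : α → ι) (w : List (α × Bool)) : wmap d (daggerW w) = daggerW (wmap d w) := by
  simp [wmap, daggerW, List.map_reverse]

/-- The reversed, flipped word denotes the adjoint. [folklore] -/
theorem ladderWord_daggerW (w : List (ι × Bool)) : ladderWord (daggerW w) = (ladderWord w)ᴴ := by
  induction w with
  | nil => simp [daggerW]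
  | cons l w ih =>
    have h : daggerW (l :: w) = daggerW w ++ [(l.1, !l.2)] := by simp [daggerW]
    rw [h, ladderWord_append'', ih, ladderWord_cons, ladderWord_cons, ladderWord_nil, mul_one,
      Matrix.conjTranspose_mul, conjTranspose_ladderLetter']

/-- **`termOp (daggerT T) = (termOp T)ᴴ`** (rational, hence real, coefficients). [folklore] -/
theorem termOp_daggerT (d : α → ι) (T : Terms α) : termOp d (daggerT T) = (termOp d T)ᴴ := by
  induction T with
  | nil => simp [daggerT]
  | cons wc T ih =>
    have h : daggerT (wc :: T) = (daggerW wc.1, wc.2) :: daggerT T := rfl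
    rw [h, termOp_cons, termOp_cons, ih, Matrix.conjTranspose_add, Matrix.conjTranspose_smul, wmap_daggerW,
      ladderWord_daggerW]
    congr 1
    rw [← Complex.ofReal_ratCast, Complex.star_def, Complex.conj_ofReal]

/-- `termOp (commT H B) = H·B − B·H`. [folklore] -/
theorem termOp_commT (d : α → ι) (H B : Terms α) :
    termOp d (commT H B) = termOp d H * termOp d B - termOp d B * termOp d H := by
  rw [commT, termOp_append, termOp_negT, termOp_mulT, termOp_mulT, sub_eq_add_neg]

omit [LinearOrder ι] [Fintype ι] in
/-- `wmap d (w.map (f × id)) = wmap (d ∘ f) w`. [folklore] -/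
theorem wmap_map (d : α → ι) (f : β → α) (w : List (β × Bool)) :
    wmap d (w.map fun l => (f l.1, l.2)) = wmap (d ∘ f) w := by
  simp [wmap]

/-- **Letter maps compose**: `termOp d (wmapT f T) = termOp (d ∘ f) T`. [folklore] -/
theorem termOp_wmapT (d : α → ι) (f : β → α) (T : Terms β) : termOp d (wmapT f T) = termOp (d ∘ f) T := by
  induction T with
  | nil => simp [wmapT]
  | cons wc T ih =>
    have h : wmapT f (wc :: T) = (wc.1.map fun l => (f l.1, l.2), wc.2) :: wmapT f T := rfl
    rw [h, termOp_cons, termOp_cons, ih, wmap_map]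

/-- `termOp` of a `flatMap` is the sum of the `termOp`s. [folklore] -/
theorem termOp_flatMap {γ : Type*} (d : α → ι) (L : List γ) (F : γ → Terms α) :
    termOp d (L.flatMap F) = (L.map fun g => termOp d (F g)).sum := by
  induction L with
  | nil => simp
  | cons g L ih => rw [List.flatMap_cons, termOp_append, ih, List.map_cons, List.sum_cons]

/-- `Σ` over `finL n` is the `Finset.univ` sum over `Fin n`. [folklore] -/
theorem sum_map_finL {M : Type*} [AddCommMonoid M] : ∀ (n : ℕ) (F : Fin n → M),
    ((finL n).map F).sum = ∑ i : Fin n, F i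
  | 0, F => by simp [finL]
  | n + 1, F => by
    rw [finL, List.map_cons, List.sum_cons, List.map_map, sum_map_finL n, Fin.sum_univ_succ]
    rfl

/-- `termOp` of a `flatMap` over `finL n` is the `Finset.univ` sum. [folklore] -/
theorem termOp_flatMap_finL (d : α → ι) (n : ℕ) (F : Fin n → Terms α) :
    termOp d ((finL n).flatMap F) = ∑ i : Fin n, termOp d (F i) := by
  rw [termOp_flatMap, sum_map_finL]

/-- A list sum indexed by positions: `(L.map G).sum = Σ_{k : Fin |L|} G (L.get k)`. [folklore] -/
theorem list_sum_map_eq_sum_fin {γ M : Type*} [AddCommMonoid M] (L : List γ) (G : γ → M) :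
    (L.map G).sum = ∑ k : Fin L.length, G (L.get k) := by
  induction L with
  | nil => simp
  | cons g L ih =>
    rw [List.map_cons, List.sum_cons, ih]
    show G g + ∑ k : Fin L.length, G (L.get k) = ∑ k : Fin (L.length + 1), G ((g :: L).get k)
    rw [Fin.sum_univ_succ]
    rfl

/-- `termOp` of a `flatMap` over a list, indexed by positions. [folklore] -/
theorem termOp_flatMap_get (d : α → ι) {γ : Type*} (L : List γ) (F : γ → Terms α) :
    termOp d (L.flatMap F) = ∑ k : Fin L.length, termOp d (F (L.get k)) := by
  rw [termOp_flatMap, list_sum_map_eq_sum_fin]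

/-- **`eomT`**: `termOp d (eomT H Bs) = Σ_k (termOp H · termOp B_k − termOp B_k · termOp H)`. [cite: Han2020Bootstrap, §3] -/
theorem termOp_eomT (d : α → ι) (H : Terms α) (Bs : List (Terms α)) :
    termOp d (eomT H Bs) = ∑ k : Fin Bs.length,
      (termOp d H * termOp d (Bs.get k) - termOp d (Bs.get k) * termOp d H) := by
  rw [eomT, termOp_flatMap_get]
  exact Finset.sum_congr rfl fun k _ => termOp_commT d H _

/-- The Gram factor operators `Oᵢ = 2^{−K} • termOp d qᵢ`. [folklore] -/
noncomputable def gramOp (d : α → ι) (K : ℕ) (Q : List (Terms α)) (i : Fin Q.length) : Matrix (Finset ι) (Finset ι) ℂ :=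
  ((((1 : ℚ) / 2 ^ K : ℚ)) : ℂ) • termOp d (Q.get i)

/-- One factor: `4^{−K} (q† q) = (2^{−K} q)ᴴ (2^{−K} q)`. [folklore] -/
theorem termOp_scaleT_mulT_daggerT (d : α → ι) (K : ℕ) (q : Terms α) :
    termOp d (scaleT (1 / 4 ^ K) (mulT (daggerT q) q)) =
      (((((1 : ℚ) / 2 ^ K : ℚ)) : ℂ) • termOp d q)ᴴ * (((((1 : ℚ) / 2 ^ K : ℚ)) : ℂ) • termOp d q) := by
  rw [termOp_scaleT, termOp_mulT, termOp_daggerT, Matrix.conjTranspose_smul, Matrix.smul_mul, Matrix.mul_smul,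
    smul_smul]
  congr 1
  have h4 : ((1 : ℚ) / 4 ^ K) = (1 / 2 ^ K) * (1 / 2 ^ K) := by
    rw [show (4 : ℚ) = 2 * 2 by norm_num, mul_pow, div_mul_div_comm, one_mul]
  rw [h4, Rat.cast_mul, ← Complex.ofReal_ratCast ((1 : ℚ) / 2 ^ K), Complex.star_def, Complex.conj_ofReal]

/-- **The SOS-factor Gram list IS a `gramForm` with the identity coefficient matrix** (`1 ⪰ 0`):
`termOp d (gramT K Q) = gramForm 1 (gramOp d K Q)`. [cite: Han2020Bootstrap, §2 eq. (2)] -/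
theorem termOp_gramT_eq_gramForm (d : α → ι) (K : ℕ) (Q : List (Terms α)) :
    termOp d (gramT K Q) = gramForm (1 : Matrix (Fin Q.length) (Fin Q.length) ℂ) (gramOp d K Q) := by
  rw [gramT, termOp_flatMap_get, gramForm]
  refine Finset.sum_congr rfl fun i _ => ?_
  rw [termOp_scaleT_mulT_daggerT]
  rw [Finset.sum_eq_single i]
  · rw [Matrix.one_apply_eq, one_smul, Matrix.star_eq_conjTranspose, gramOp]
  · intro j _ hji
    rw [Matrix.one_apply_ne (Ne.symm hji), zero_smul]
  · intro hi; exact absurd (Finset.mem_univ i) hi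

/-- The identity coefficient matrix is positive semidefinite. [folklore] -/
theorem posSemidef_one_fin (n : ℕ) : (1 : Matrix (Fin n) (Fin n) ℂ).PosSemidef := Matrix.PosSemidef.one

/-- **The engine's soundness in `termOp` form**: `evalPoly d (termsToPoly T) = termOp d T`. [cite: BratteliRobinsonII1997, §5.2.2] -/
theorem evalPoly_termsToPoly' [LinearOrder α] {d : α → ι} (hd : Function.Injective d) (T : Terms α) :
    evalPoly d (termsToPoly T) = termOp d T :=
  evalPoly_termsToPoly hd T

/-- **`evalPoly d (normalize enc B T) = termOp d T`.** [cite: BratteliRobinsonII1997, §5.2.2] -/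
theorem evalPoly_normalize' [LinearOrder α] {d : α → ι} (hd : Function.Injective d) (enc : α → ℕ) (B : ℕ) (T : Terms α) :
    evalPoly d (CARPoly.normalize enc B T) = termOp d T :=
  evalPoly_normalize hd enc B T

omit [LinearOrder ι] [Fintype ι] in
/-- **Charges are computable on the syntax**: `ladderCharge (wmap d w) = chargeW w`. [folklore] -/
theorem ladderCharge_wmap (d : α → ι) (w : List (α × Bool)) : ladderCharge (wmap d w) = chargeW w := by
  induction w with
  | nil => simp [chargeW]
  | cons p w ih =>
    rw [wmap_cons, ladderCharge_cons, ih]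
    simp [chargeW]

end Semantics

section SpinCharge

variable {α : Type*} {Λ : Type*} [LinearOrder Λ] [Fintype Λ]

omit [LinearOrder Λ] [Fintype Λ] in
/-- **Spin charges are computable on the syntax**: if `sp a` is the spin of the orbital `d a`, then
`ladderSpinCharge (wmap d w) = spinChargeW sp w`. [folklore] -/
theorem ladderSpinCharge_wmap (d : α → Orb Λ) (sp : α → Fin 2) (hsp : ∀ a, (ofLex (d a)).2 = sp a)
    (w : List (α × Bool)) : ladderSpinCharge (wmap d w) = spinChargeW sp w := by
  induction w with
  | nil => simp [spinChargeW]
  | cons p w ih =>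
    rw [wmap_cons, ladderSpinCharge_cons, ih]
    simp [spinChargeW, letterSpinCharge, hsp]

/-- **`Γ(φ)` acts letterwise on term lists**: `Γ(φ) (termOp d T) = termOp (embMap φ ∘ d) T`. [cite: BratteliRobinsonII1997, §5.2.2] -/
theorem fermionEmbed_termOp {Λ' : Type*} [LinearOrder Λ'] [Fintype Λ'] (φ : Λ ↪ Λ') (d : α → Orb Λ) (T : Terms α) :
    fermionEmbed φ (termOp d T) = termOp (Orb.embMap φ ∘ d) T := by
  induction T with
  | nil => simp [termOp]
  | cons wc T ih =>
    rw [termOp_cons, termOp_cons, map_add, map_smul, ih, fermionEmbed_ladderWord]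
    congr 2
    simp only [wmap, List.map_map, Function.comp_def]

end SpinCharge

end CARPolyWindow

end Summit.Ventures.CertifiedManyBodySolver
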